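import Summits.Ventures.PercRepro.RankLevelSetLevelSevenRowSixtyFive
import Summits.Ventures.PercRepro.RankLevelSetLevelSevenRowSixtyFour
import Summits.Ventures.PercRepro.RankLevelSetLevelSevenRowSixtyThree
import Summits.Ventures.PercRepro.RankLevelSetLevelSevenRowSixtyTwo
import Summits.Ventures.PercRepro.RankLevelSetLevelSevenRowSixtyOne
import Summits.Ventures.PercRepro.RankLevelSetLevelSevenRowSixty
import Summits.Ventures.PercRepro.RankLevelSetLevelSevenRowFiftyNine
import Summits.Ventures.PercRepro.RankLevelSetLevelSevenRowFiftyEight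
import Summits.Ventures.PercRepro.RankLevelSetLevelSevenRowFiftySeven
import Summits.Ventures.PercRepro.RankLevelSetLevelSevenRowFiftySix

/-!
# PercRepro — THE ROWS `64 … 56` OF LEVEL `7`: C-025 AT `q = 7` FOR EVERY FINITE MATROID AND EVERY `p ≥ 56`, ON THE
TELESCOPING COUNT (p8, gen 20; a feeder for S4 — the top of the `q = 7` window moves from `65` to `56`)

Each row from the row above and its own rank: `c025_seven_large_<word> (P ≤ p) : RLS M p 7` is `c025_seven_at_<word>`
(RankLevelSetLevelSevenRow<Word>: the `e`-free core at rank `P` on the telescoping count, `rls_succ_large_at 6 7 P` on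
`c025_six_all`) at `p = P` and the row `P + 1` above it; the row `65` is p8 g19's `c025_seven_large_sixty_five`
(RankLevelSetLevelSevenRowSixtyFive). The chain `64 → 63 → … → 56`; the literal `C025` body at `56`
(`c025_seven_fifty_six`). Axioms: standard.
-/

open scoped Matroid

namespace PercRepro

namespace ThmN

variable {α : Type}

/-- **THEOREM C₇ AT `64`, UNCONDITIONAL OVER THE TREE**: every finite matroid satisfies C-025 at level `7` for every
`p ≥ 64` — the row `64` by `c025_seven_at_sixty_four`, the rows `≥ 65` by `c025_seven_large_sixty_five`. -/
theorem c025_seven_large_sixty_four (M : Matroid α) [M.Finite] (p : ℕ) (hp : 64 ≤ p) : RLS M p 7 := by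
  rcases Nat.lt_or_ge p 65 with h | h
  · have h64 : p = 64 := by omega
    subst h64
    exact c025_seven_at_sixty_four M
  · exact c025_seven_large_sixty_five M p h

/-- **THEOREM C₇ AT `63`, UNCONDITIONAL OVER THE TREE**: every finite matroid satisfies C-025 at level `7` for every
`p ≥ 63` — the row `63` by `c025_seven_at_sixty_three`, the rows `≥ 64` by `c025_seven_large_sixty_four`. -/
theorem c025_seven_large_sixty_three (M : Matroid α) [M.Finite] (p : ℕ) (hp : 63 ≤ p) : RLS M p 7 := by
  rcases Nat.lt_or_ge p 64 with h | h
  · have h63 : p = 63 := by omega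
    subst h63
    exact c025_seven_at_sixty_three M
  · exact c025_seven_large_sixty_four M p h

/-- **THEOREM C₇ AT `62`, UNCONDITIONAL OVER THE TREE**: every finite matroid satisfies C-025 at level `7` for every
`p ≥ 62` — the row `62` by `c025_seven_at_sixty_two`, the rows `≥ 63` by `c025_seven_large_sixty_three`. -/
theorem c025_seven_large_sixty_two (M : Matroid α) [M.Finite] (p : ℕ) (hp : 62 ≤ p) : RLS M p 7 := by
  rcases Nat.lt_or_ge p 63 with h | h
  · have h62 : p = 62 := by omega
    subst h62
    exact c025_seven_at_sixty_two M
  · exact c025_seven_large_sixty_three M p h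

/-- **THEOREM C₇ AT `61`, UNCONDITIONAL OVER THE TREE**: every finite matroid satisfies C-025 at level `7` for every
`p ≥ 61` — the row `61` by `c025_seven_at_sixty_one`, the rows `≥ 62` by `c025_seven_large_sixty_two`. -/
theorem c025_seven_large_sixty_one (M : Matroid α) [M.Finite] (p : ℕ) (hp : 61 ≤ p) : RLS M p 7 := by
  rcases Nat.lt_or_ge p 62 with h | h
  · have h61 : p = 61 := by omega
    subst h61
    exact c025_seven_at_sixty_one M
  · exact c025_seven_large_sixty_two M p h

/-- **THEOREM C₇ AT `60`, UNCONDITIONAL OVER THE TREE**: every finite matroid satisfies C-025 at level `7` for every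
`p ≥ 60` — the row `60` by `c025_seven_at_sixty`, the rows `≥ 61` by `c025_seven_large_sixty_one`. -/
theorem c025_seven_large_sixty (M : Matroid α) [M.Finite] (p : ℕ) (hp : 60 ≤ p) : RLS M p 7 := by
  rcases Nat.lt_or_ge p 61 with h | h
  · have h60 : p = 60 := by omega
    subst h60
    exact c025_seven_at_sixty M
  · exact c025_seven_large_sixty_one M p h

/-- **THEOREM C₇ AT `59`, UNCONDITIONAL OVER THE TREE**: every finite matroid satisfies C-025 at level `7` for every
`p ≥ 59` — the row `59` by `c025_seven_at_fifty_nine`, the rows `≥ 60` by `c025_seven_large_sixty`. -/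
theorem c025_seven_large_fifty_nine (M : Matroid α) [M.Finite] (p : ℕ) (hp : 59 ≤ p) : RLS M p 7 := by
  rcases Nat.lt_or_ge p 60 with h | h
  · have h59 : p = 59 := by omega
    subst h59
    exact c025_seven_at_fifty_nine M
  · exact c025_seven_large_sixty M p h

/-- **THEOREM C₇ AT `58`, UNCONDITIONAL OVER THE TREE**: every finite matroid satisfies C-025 at level `7` for every
`p ≥ 58` — the row `58` by `c025_seven_at_fifty_eight`, the rows `≥ 59` by `c025_seven_large_fifty_nine`. -/
theorem c025_seven_large_fifty_eight (M : Matroid α) [M.Finite] (p : ℕ) (hp : 58 ≤ p) : RLS M p 7 := by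
  rcases Nat.lt_or_ge p 59 with h | h
  · have h58 : p = 58 := by omega
    subst h58
    exact c025_seven_at_fifty_eight M
  · exact c025_seven_large_fifty_nine M p h

/-- **THEOREM C₇ AT `57`, UNCONDITIONAL OVER THE TREE**: every finite matroid satisfies C-025 at level `7` for every
`p ≥ 57` — the row `57` by `c025_seven_at_fifty_seven`, the rows `≥ 58` by `c025_seven_large_fifty_eight`. -/
theorem c025_seven_large_fifty_seven (M : Matroid α) [M.Finite] (p : ℕ) (hp : 57 ≤ p) : RLS M p 7 := by
  rcases Nat.lt_or_ge p 58 with h | h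
  · have h57 : p = 57 := by omega
    subst h57
    exact c025_seven_at_fifty_seven M
  · exact c025_seven_large_fifty_eight M p h

/-- **THEOREM C₇ AT `56`, UNCONDITIONAL OVER THE TREE**: every finite matroid satisfies C-025 at level `7` for every
`p ≥ 56` — the row `56` by `c025_seven_at_fifty_six`, the rows `≥ 57` by `c025_seven_large_fifty_seven`. -/
theorem c025_seven_large_fifty_six (M : Matroid α) [M.Finite] (p : ℕ) (hp : 56 ≤ p) : RLS M p 7 := by
  rcases Nat.lt_or_ge p 57 with h | h
  · have h56 : p = 56 := by omega
    subst h56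
    exact c025_seven_at_fifty_six M
  · exact c025_seven_large_fifty_seven M p h

/-- The same in the literal `C025` body: `phiK p 7 · #U(p, 7) ≤ #Y(p, 7)` for every finite matroid and every `p ≥ 56`. -/
theorem c025_seven_fifty_six (M : Matroid α) [M.Finite] (p : ℕ) (hp : 56 ≤ p) :
    phiK p 7 * ({A : Set α | A ⊆ M.E ∧ M.eRk A = (p : ℕ∞) ∧ M.eRk (M.E \ A) = (7 : ℕ∞)}.ncard : ℚ) ≤
      ({A : Set α | A ⊆ M.E ∧ (7 : ℕ∞) < M.eRk A ∧ M.eRk A < (p : ℕ∞)}.ncard : ℚ) :=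
  c025_seven_large_fifty_six M p hp

end ThmN

end PercRepro
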